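import Mathlib

/-!
# The discrete layer cake and the three-case state lemma (blind cell PercRepro2, night-2 g14;
proofs/NIGHT2-DARC.md §49)

`sum_mul_nonneg_of_levels`: if every level sum `∑_{t ≤ w i} c i` (`t > w₀`) is nonnegative and
`w₀ · ∑ c ≥ 0`, then `∑ c i · w i ≥ 0` — the finite layer cake of `w` over its level sets,
by induction on the number of values of `w` above `w₀`.

`csl_main` (the CLEAN STATE LEMMA): for nonnegative masses `n` and two functions `u, w` bounded
below by `u₀, w₀ ≤ 0` on the support, with the FKG inequality and nonnegative level sums,
`∑ n u w ≥ 0`: if `∑ n u ≤ 0` the layer cake of `w`, if `∑ n w ≤ 0` the layer cake of `u`,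
otherwise FKG. -/

namespace Summit.Ventures.PercRepro2.Coin

section Layer

variable {ι : Type*} {R : Type*} [Field R] [LinearOrder R] [IsStrictOrderedRing R]

/-- The layer-cake induction on the number of values above `w₀`. -/
lemma layer_aux (s : Finset ι) (c : ι → R) (w₀ : R) (h0 : 0 ≤ w₀ * ∑ i ∈ s, c i) :
    ∀ (m : ℕ) (w : ι → R), (((s.image w).filter (fun v => w₀ < v))).card ≤ m →
      (∀ i ∈ s, w₀ ≤ w i) →
      (∀ t, w₀ < t → 0 ≤ ∑ i ∈ s.filter (fun i => t ≤ w i), c i) →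
      0 ≤ ∑ i ∈ s, c i * w i := by
  intro m
  induction m with
  | zero =>
    intro w hcard hw _
    have hempty : ((s.image w).filter (fun v => w₀ < v)) = ∅ := Finset.card_eq_zero.mp (Nat.le_zero.mp hcard)
    have hconst : ∀ i ∈ s, w i = w₀ := by
      intro i hi
      by_contra hne
      have hlt : w₀ < w i := lt_of_le_of_ne (hw i hi) (Ne.symm hne)
      have hmem : w i ∈ ((s.image w).filter (fun v => w₀ < v)) := by
        rw [Finset.mem_filter, Finset.mem_image]
        exact ⟨⟨i, hi, rfl⟩, hlt⟩
      rw [hempty] at hmem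
      exact Finset.notMem_empty _ hmem
    have : (∑ i ∈ s, c i * w i) = w₀ * ∑ i ∈ s, c i := by
      rw [Finset.mul_sum]
      exact Finset.sum_congr rfl fun i hi => by rw [hconst i hi, mul_comm]
    rw [this]; exact h0
  | succ m ih =>
    intro w hcard hw hlev
    by_cases hemp : ((s.image w).filter (fun v => w₀ < v)) = ∅
    · exact ih w (by rw [hemp, Finset.card_empty]; exact Nat.zero_le _) hw hlev
    · have hne : (((s.image w).filter (fun v => w₀ < v))).Nonempty := Finset.nonempty_iff_ne_empty.mpr hemp
      set a := (((s.image w).filter (fun v => w₀ < v))).min' hne with ha_def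
      have ha_mem : a ∈ ((s.image w).filter (fun v => w₀ < v)) := Finset.min'_mem _ hne
      have ha_gt : w₀ < a := (Finset.mem_filter.mp ha_mem).2
      have ha_min : ∀ i ∈ s, w₀ < w i → a ≤ w i := by
        intro i hi hlt
        apply Finset.min'_le
        rw [Finset.mem_filter, Finset.mem_image]
        exact ⟨⟨i, hi, rfl⟩, hlt⟩
      have hlow : ∀ i ∈ s, w i < a → w i = w₀ := by
        intro i hi hlt
        by_contra hne'
        have : w₀ < w i := lt_of_le_of_ne (hw i hi) (Ne.symm hne')
        exact absurd (ha_min i hi this) (not_le.mpr hlt)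
      -- the shifted function: the lowest level above `w₀` is collapsed onto `w₀`
      set w' : ι → R := fun i => if a ≤ w i then w i - (a - w₀) else w i with hw'_def
      have hw' : ∀ i ∈ s, w₀ ≤ w' i := by
        intro i hi
        simp only [hw'_def]
        split_ifs with h
        · linarith
        · exact hw i hi
      -- the level sets of `w'` above `w₀` are level sets of `w`
      have hlev' : ∀ t, w₀ < t → 0 ≤ ∑ i ∈ s.filter (fun i => t ≤ w' i), c i := by
        intro t ht
        have hset : s.filter (fun i => t ≤ w' i) = s.filter (fun i => t + (a - w₀) ≤ w i) := by
          ext i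
          simp only [Finset.mem_filter, hw'_def]
          constructor
          · rintro ⟨hi, hti⟩
            refine ⟨hi, ?_⟩
            split_ifs at hti with h
            · linarith
            · have := hlow i hi (not_le.mp h)
              linarith
          · rintro ⟨hi, hti⟩
            refine ⟨hi, ?_⟩
            have hai : a ≤ w i := by linarith
            rw [if_pos hai]
            linarith
        rw [hset]
        exact hlev (t + (a - w₀)) (by linarith)
      -- the values of `w'` above `w₀` are the values of `w` above `a`, shifted
      have hcard' : (((s.image w').filter (fun v => w₀ < v))).card ≤ m := by
        have hsub : ((s.image w').filter (fun v => w₀ < v)) ⊆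
            ((((s.image w).filter (fun v => w₀ < v))).erase a).image (fun v => v - (a - w₀)) := by
          intro v hv
          rw [Finset.mem_filter, Finset.mem_image] at hv
          obtain ⟨⟨i, hi, rfl⟩, hv0⟩ := hv
          rw [Finset.mem_image]
          simp only [hw'_def] at hv0 ⊢
          split_ifs at hv0 ⊢ with h
          · refine ⟨w i, ?_, rfl⟩
            rw [Finset.mem_erase]
            refine ⟨?_, ?_⟩
            · intro heq; rw [heq] at hv0; linarith
            · rw [Finset.mem_filter, Finset.mem_image]
              exact ⟨⟨i, hi, rfl⟩, by linarith⟩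
          · exfalso
            have := hlow i hi (not_le.mp h)
            linarith
        calc (((s.image w').filter (fun v => w₀ < v))).card
            ≤ (((((s.image w).filter (fun v => w₀ < v))).erase a).image (fun v => v - (a - w₀))).card :=
              Finset.card_le_card hsub
          _ ≤ ((((s.image w).filter (fun v => w₀ < v))).erase a).card := Finset.card_image_le
          _ = (((s.image w).filter (fun v => w₀ < v))).card - 1 := Finset.card_erase_of_mem ha_mem
          _ ≤ m := by omega
      -- the decomposition
      have hdec : (∑ i ∈ s, c i * w i) =
          (∑ i ∈ s, c i * w' i) + (a - w₀) * ∑ i ∈ s.filter (fun i => a ≤ w i), c i := by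
        rw [Finset.sum_filter, Finset.mul_sum, ← Finset.sum_add_distrib]
        refine Finset.sum_congr rfl fun i hi => ?_
        simp only [hw'_def]
        split_ifs with h
        · ring
        · ring
      rw [hdec]
      have h1 := ih w' hcard' hw' hlev'
      have h2 := hlev a ha_gt
      have h3 : 0 ≤ a - w₀ := by linarith
      exact add_nonneg h1 (mul_nonneg h3 h2)

/-- **The discrete layer cake.** If `w ≥ w₀` on the support of `c`, `w₀ · ∑ c ≥ 0`, and every
level sum `∑_{t ≤ w i} c i` with `t > w₀` is nonnegative, then `∑ c i · w i ≥ 0`. -/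
theorem sum_mul_nonneg_of_levels (s : Finset ι) (c w : ι → R) (w₀ : R)
    (hw : ∀ i ∈ s, c i ≠ 0 → w₀ ≤ w i) (h0 : 0 ≤ w₀ * ∑ i ∈ s, c i)
    (hlev : ∀ t, w₀ < t → 0 ≤ ∑ i ∈ s.filter (fun i => t ≤ w i), c i) :
    0 ≤ ∑ i ∈ s, c i * w i := by
  set s' := s.filter (fun i => c i ≠ 0) with hs'
  have hsum : ∀ f : ι → R, (∑ i ∈ s, c i * f i) = ∑ i ∈ s', c i * f i := by
    intro f
    rw [hs', Finset.sum_filter]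
    refine Finset.sum_congr rfl fun i _ => ?_
    by_cases h : c i = 0
    · simp [h]
    · simp [h]
  have hsum1 : (∑ i ∈ s, c i) = ∑ i ∈ s', c i := by
    have := hsum (fun _ => 1)
    simpa only [mul_one] using this
  have hlev' : ∀ t, w₀ < t → 0 ≤ ∑ i ∈ s'.filter (fun i => t ≤ w i), c i := by
    intro t ht
    have e : s'.filter (fun i => t ≤ w i) =
        (s.filter (fun i => t ≤ w i)).filter (fun i => c i ≠ 0) := by
      rw [hs', Finset.filter_filter, Finset.filter_filter]
      exact Finset.filter_congr fun i _ => and_comm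
    rw [e, Finset.sum_filter]
    have : (∑ i ∈ s.filter (fun i => t ≤ w i), if c i ≠ 0 then c i else 0) =
        ∑ i ∈ s.filter (fun i => t ≤ w i), c i := by
      refine Finset.sum_congr rfl fun i _ => ?_
      by_cases h : c i = 0
      · simp [h]
      · simp [h]
    rw [this]
    exact hlev t ht
  rw [hsum w]
  refine layer_aux s' c w₀ (by rw [← hsum1]; exact h0) (((s'.image w).filter (fun v => w₀ < v))).card w le_rfl ?_ hlev'
  intro i hi
  rw [hs', Finset.mem_filter] at hi
  exact hw i hi.1 hi.2

/-- **THE CLEAN STATE LEMMA (three cases).** `n ≥ 0`; `u ≥ u₀`, `w ≥ w₀` on the support of `n`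
with `u₀, w₀ ≤ 0`; the FKG inequality `(∑ n u)(∑ n w) ≤ (∑ n)(∑ n u w)`; all level sums
`∑_{t ≤ w i} n u` (`t > w₀`) and `∑_{t ≤ u i} n w` (`t > u₀`) nonnegative. Then `∑ n u w ≥ 0`. -/
theorem csl_main (s : Finset ι) (n u w : ι → R) (hn : ∀ i ∈ s, 0 ≤ n i)
    (u₀ w₀ : R) (hu₀ : u₀ ≤ 0) (hw₀ : w₀ ≤ 0)
    (hu : ∀ i ∈ s, n i ≠ 0 → u₀ ≤ u i) (hw : ∀ i ∈ s, n i ≠ 0 → w₀ ≤ w i)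
    (hfkg : (∑ i ∈ s, n i * u i) * (∑ i ∈ s, n i * w i) ≤
      (∑ i ∈ s, n i) * ∑ i ∈ s, n i * u i * w i)
    (hlevw : ∀ t, w₀ < t → 0 ≤ ∑ i ∈ s.filter (fun i => t ≤ w i), n i * u i)
    (hlevu : ∀ t, u₀ < t → 0 ≤ ∑ i ∈ s.filter (fun i => t ≤ u i), n i * w i) :
    0 ≤ ∑ i ∈ s, n i * u i * w i := by
  by_cases hSu : (∑ i ∈ s, n i * u i) ≤ 0
  · -- layer cake of `w`
    have := sum_mul_nonneg_of_levels s (fun i => n i * u i) w w₀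
      (fun i hi h => hw i hi (fun hn0 => h (by rw [hn0, zero_mul])))
      (mul_nonneg_of_nonpos_of_nonpos hw₀ hSu) hlevw
    simpa only [mul_assoc] using this
  · by_cases hSw : (∑ i ∈ s, n i * w i) ≤ 0
    · -- layer cake of `u`
      have := sum_mul_nonneg_of_levels s (fun i => n i * w i) u u₀
        (fun i hi h => hu i hi (fun hn0 => h (by rw [hn0, zero_mul])))
        (mul_nonneg_of_nonpos_of_nonpos hu₀ hSw) hlevu
      have e : (∑ i ∈ s, n i * w i * u i) = ∑ i ∈ s, n i * u i * w i :=
        Finset.sum_congr rfl fun i _ => by ring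
      rw [← e]; exact this
    · -- FKG
      have hpos : 0 < (∑ i ∈ s, n i * u i) * (∑ i ∈ s, n i * w i) :=
        mul_pos (not_le.mp hSu) (not_le.mp hSw)
      have hN : 0 ≤ ∑ i ∈ s, n i := Finset.sum_nonneg hn
      by_contra hneg
      have : (∑ i ∈ s, n i) * (∑ i ∈ s, n i * u i * w i) ≤ 0 :=
        mul_nonpos_of_nonneg_of_nonpos hN (not_le.mp hneg).le
      linarith

end Layer

end Summit.Ventures.PercRepro2.Coin
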